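import Mathlib

/-!
# LEMMA E — the two-cusp PURIFIER: a q-Farey pair of cusps in one denominator fibre is moved by some `δ ∈ Γ₀(N)` to cusps with
# `q`-power denominators (MEMO-an §72.3, PROOFS-an-72 §2; rung L3 of the formalisation ladder §72.7; an g30 ask «p2 (ii)»)

Summit `BirchSwinnertonDyer`, route `ManinLocalTwoThree` (cell bsd-f2-manin, analytic lens), cruxes C3 `ManinPrimeToThreeAtNine`
(stmt-BirchSwinnertonDyer-22968) / C2 `ManinOddAtFour` (stmt-…-22967).  Over `ℤ` only (no `ℤ[1/q]` matrices): for cusps `x = B/D`, `y = B′/D′` with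
`(B, D) = 1`, `D′ ≡ ±qᵗ·D (mod N)` (both denominators in the fibre `±⟨q⟩·D`) and `B D′ − B′ D = ±qᵉ` (a q-FAREY EDGE), there is
`δ = (∗ ∗; u v) ∈ Γ₀(N)` with `u B + v D = ±qᵐ` and `u B′ + v D′ = qᵉ` — i.e. `δx` and `δy` have `q`-power denominators, `δx, δy ∈ ℤ[1/q]`.

* `exists_bottom_row_qPower` — the bottom row `(u, v)`: `N ∣ u`, `IsCoprime u v`, `uB + vD = ±qᵐ`, `uB′ + vD′ = qᵉ` (Cramer with
  `m − e = (t+1)·φ(N) − t ≥ 1`, so that `q^{m−e+t} ≡ 1 (mod N)`; coprimality from `(B, D) = 1` read modulo `q`).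
* `exists_gamma0_bottom_row_qPower` — completion to `δ ∈ Γ₀(N)` (`SL(2, ℤ)` with `N ∣ δ₁₀`).

HONEST FRAMING: elementary integer algebra; the q-Farey connectivity E-an-140 / generation E-an-141 and everything about Manin's conjecture or
BSD are untouched.  No definitions.
-/

set_option linter.dupNamespace false
set_option autoImplicit false

namespace Summit.BirchSwinnertonDyer.BirchSwinnertonDyer.Theorems.ManinLocalTwoThree

open scoped MatrixGroups
open CongruenceSubgroup

/-- `(q : ZMod N)^φ(N) = 1` for `q` prime to `N` (Euler). -/
theorem zmod_pow_totient_eq_one_of_coprime {N q : ℕ} [NeZero N] (hqN : q.Coprime N) :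
    (q : ZMod N) ^ Nat.totient N = 1 := by
  have h := ZMod.pow_totient (ZMod.unitOfCoprime q hqN)
  rw [Units.ext_iff, Units.val_pow_eq_pow_val, ZMod.coe_unitOfCoprime, Units.val_one] at h
  exact h

/-- **LEMMA E, bottom row** (PROOFS-an-72 §2).  `q` prime to `N`, `(B, D) = 1`, `D′ ≡ ε qᵗ D (mod N)` and `B D′ − B′ D = η qᵉ` with
`ε, η = ±1`: there are `u, v ∈ ℤ` with `N ∣ u`, `(u, v) = 1`, `u B + v D = ε qᵐ` for some `m`, and `u B′ + v D′ = qᵉ`. [folklore] -/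
theorem exists_bottom_row_qPower {N q : ℕ} [NeZero N] (hq : q.Prime) (hqN : q.Coprime N) {B B' : ℤ} {D D' : ℤ}
    (hBD : IsCoprime B D) {ε : ℤ} (hε : ε = 1 ∨ ε = -1) {t : ℕ} (hrel : (D' : ZMod N) = (ε : ZMod N) * (q : ZMod N) ^ t * (D : ZMod N))
    {η : ℤ} (hη : η = 1 ∨ η = -1) {e : ℕ} (hdet : B * D' - B' * D = η * (q : ℤ) ^ e) :
    ∃ u v : ℤ, (N : ℤ) ∣ u ∧ IsCoprime u v ∧ (∃ m : ℕ, u * B + v * D = ε * (q : ℤ) ^ m) ∧ u * B' + v * D' = (q : ℤ) ^ e := by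
  have hε2 : ε * ε = 1 := by rcases hε with rfl | rfl <;> norm_num
  have hη2 : η * η = 1 := by rcases hη with rfl | rfl <;> norm_num
  -- the exponent gap `L = m − e = (t+1)φ − t ≥ 1`, with `L + t = (t+1)φ`
  set φ : ℕ := Nat.totient N with hφ
  have hφ1 : 1 ≤ φ := Nat.totient_pos.mpr (NeZero.pos N)
  set L : ℕ := (t + 1) * φ - t with hL
  have hL1 : 1 ≤ L := by
    have : t + 1 ≤ (t + 1) * φ := Nat.le_mul_of_pos_right _ hφ1
    omega
  have hLt : L + t = (t + 1) * φ := by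
    have : t + 1 ≤ (t + 1) * φ := Nat.le_mul_of_pos_right _ hφ1
    omega
  have hqpow : (q : ZMod N) ^ (L + t) = 1 := by
    rw [hLt, mul_comm, pow_mul, zmod_pow_totient_eq_one_of_coprime hqN, one_pow]
  -- Cramer
  refine ⟨η * (ε * (q : ℤ) ^ L * D' - D), η * (B - ε * (q : ℤ) ^ L * B'), ?_, ?_, ⟨L + e, ?_⟩, ?_⟩
  · -- `N ∣ u`: modulo `N`, `u = η D (ε² q^{L+t} − 1) = 0`
    rw [← ZMod.intCast_zmod_eq_zero_iff_dvd]
    push_cast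
    rw [hrel]
    have hεN : (ε : ZMod N) * (ε : ZMod N) = 1 := by
      have h := congrArg (Int.cast : ℤ → ZMod N) hε2
      push_cast at h
      exact h
    have hqLt : (q : ZMod N) ^ L * (q : ZMod N) ^ t = 1 := by rw [← pow_add]; exact hqpow
    linear_combination ((η : ZMod N) * (D : ZMod N) * ((q : ZMod N) ^ L * (q : ZMod N) ^ t)) * hεN
      + ((η : ZMod N) * (D : ZMod N)) * hqLt
  · -- coprimality, read modulo `q`
    have hqL : (q : ℤ) ∣ (q : ℤ) ^ L := dvd_pow_self _ (by omega)
    have key' : (η * (ε * (q : ℤ) ^ L * D' - D)) * B' + (η * (B - ε * (q : ℤ) ^ L * B')) * D' = (q : ℤ) ^ e := by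
      linear_combination η * hdet + ((q : ℤ) ^ e) * hη2
    have hnot : ¬ ((q : ℤ) ∣ η * (ε * (q : ℤ) ^ L * D' - D) ∧ (q : ℤ) ∣ η * (B - ε * (q : ℤ) ^ L * B')) := by
      rintro ⟨hu, hv⟩
      -- `q ∣ u + ηD` and `q ∣ v − ηB`, so `q ∣ D` and `q ∣ B`
      have hD : (q : ℤ) ∣ D := by
        have h1 : (q : ℤ) ∣ η * (ε * (q : ℤ) ^ L * D') := Dvd.dvd.mul_left (Dvd.dvd.mul_right (Dvd.dvd.mul_left hqL ε) D') η
        have h2 : (q : ℤ) ∣ η * (ε * (q : ℤ) ^ L * D') - η * (ε * (q : ℤ) ^ L * D' - D) := dvd_sub h1 hu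
        have h3 : η * (ε * (q : ℤ) ^ L * D') - η * (ε * (q : ℤ) ^ L * D' - D) = η * D := by ring
        rw [h3] at h2
        have h4 : (q : ℤ) ∣ η * (η * D) := Dvd.dvd.mul_left h2 η
        rwa [← mul_assoc, hη2, one_mul] at h4
      have hB : (q : ℤ) ∣ B := by
        have h1 : (q : ℤ) ∣ η * (ε * (q : ℤ) ^ L * B') := Dvd.dvd.mul_left (Dvd.dvd.mul_right (Dvd.dvd.mul_left hqL ε) B') η
        have h2 : (q : ℤ) ∣ η * (B - ε * (q : ℤ) ^ L * B') + η * (ε * (q : ℤ) ^ L * B') := dvd_add hv h1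
        have h3 : η * (B - ε * (q : ℤ) ^ L * B') + η * (ε * (q : ℤ) ^ L * B') = η * B := by ring
        rw [h3] at h2
        have h4 : (q : ℤ) ∣ η * (η * B) := Dvd.dvd.mul_left h2 η
        rwa [← mul_assoc, hη2, one_mul] at h4
      have hunit := hBD.isUnit_of_dvd' hB hD
      rw [Int.isUnit_iff_natAbs_eq, Int.natAbs_natCast] at hunit
      exact hq.one_lt.ne' hunit
    -- one of `u`, `v` is prime to `q`
    have hcop_of_not_dvd : ∀ z : ℤ, ¬ (q : ℤ) ∣ z → IsCoprime (q : ℤ) z := fun z hz ↦ by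
      rw [Int.isCoprime_iff_gcd_eq_one]
      exact (Nat.Prime.coprime_iff_not_dvd hq).mpr fun h ↦ hz (Int.natCast_dvd.mpr h)
    by_cases hu : (q : ℤ) ∣ η * (ε * (q : ℤ) ^ L * D' - D)
    · have hv : ¬ (q : ℤ) ∣ η * (B - ε * (q : ℤ) ^ L * B') := fun hv ↦ hnot ⟨hu, hv⟩
      have hqv : IsCoprime ((q : ℤ) ^ e) (η * (B - ε * (q : ℤ) ^ L * B')) := (hcop_of_not_dvd _ hv).pow_left
      -- `v ⊥ q^e = uB′ + vD′` ⟹ `v ⊥ uB′` ⟹ `v ⊥ u`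
      have h1 : IsCoprime (η * (B - ε * (q : ℤ) ^ L * B')) ((η * (ε * (q : ℤ) ^ L * D' - D)) * B' +
          (η * (B - ε * (q : ℤ) ^ L * B')) * D') := by rw [key']; exact hqv.symm
      exact (IsCoprime.of_add_mul_left_right h1).of_mul_right_left.symm
    · have hqu : IsCoprime ((q : ℤ) ^ e) (η * (ε * (q : ℤ) ^ L * D' - D)) := (hcop_of_not_dvd _ hu).pow_left
      have h1 : IsCoprime (η * (ε * (q : ℤ) ^ L * D' - D)) ((η * (B - ε * (q : ℤ) ^ L * B')) * D' +
          (η * (ε * (q : ℤ) ^ L * D' - D)) * B') := by rw [add_comm, key']; exact hqu.symm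
      exact (IsCoprime.of_add_mul_left_right h1).of_mul_right_left
  · -- `uB + vD = ε q^{L+e}`
    rw [pow_add]
    linear_combination (η * ε * (q : ℤ) ^ L) * hdet + (ε * (q : ℤ) ^ L * (q : ℤ) ^ e) * hη2
  · -- `uB′ + vD′ = q^e`
    linear_combination η * hdet + ((q : ℤ) ^ e) * hη2

/-- **LEMMA E** (PROOFS-an-72 §2): completion of the bottom row to `δ = (∗ ∗; u v) ∈ Γ₀(N)`; `δ·(B/D)` and `δ·(B′/D′)` then have
denominators `|uB + vD| = qᵐ` and `uB′ + vD′ = qᵉ` — both cusps lie in `ℤ[1/q]`. [folklore] -/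
theorem exists_gamma0_bottom_row_qPower {N q : ℕ} [NeZero N] (hq : q.Prime) (hqN : q.Coprime N) {B B' : ℤ} {D D' : ℤ}
    (hBD : IsCoprime B D) {ε : ℤ} (hε : ε = 1 ∨ ε = -1) {t : ℕ} (hrel : (D' : ZMod N) = (ε : ZMod N) * (q : ZMod N) ^ t * (D : ZMod N))
    {η : ℤ} (hη : η = 1 ∨ η = -1) {e : ℕ} (hdet : B * D' - B' * D = η * (q : ℤ) ^ e) :
    ∃ δ : SL(2, ℤ), δ ∈ Gamma0 N ∧ (∃ m : ℕ, (δ 1 0 : ℤ) * B + (δ 1 1 : ℤ) * D = ε * (q : ℤ) ^ m) ∧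
      (δ 1 0 : ℤ) * B' + (δ 1 1 : ℤ) * D' = (q : ℤ) ^ e := by
  obtain ⟨u, v, hNu, huv, ⟨m, hm⟩, he⟩ := exists_bottom_row_qPower hq hqN hBD hε hrel hη hdet
  obtain ⟨s, s', hss⟩ := huv
  -- `δ = (s' , -s ; u , v)` has determinant `s' v + s u = 1`
  let M : Matrix (Fin 2) (Fin 2) ℤ := !![s', -s; u, v]
  have hdetM : M.det = 1 := by
    rw [Matrix.det_fin_two_of]
    linear_combination hss
  refine ⟨⟨M, hdetM⟩, ?_, ⟨m, ?_⟩, ?_⟩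
  · rw [Gamma0_mem]
    show ((M 1 0 : ℤ) : ZMod N) = 0
    simp only [M, Matrix.of_apply, Matrix.cons_val', Matrix.cons_val_zero, Matrix.cons_val_one,
      Matrix.cons_val_fin_one]
    exact (ZMod.intCast_zmod_eq_zero_iff_dvd u N).mpr hNu
  · show (M 1 0 : ℤ) * B + (M 1 1 : ℤ) * D = ε * (q : ℤ) ^ m
    simp only [M, Matrix.of_apply, Matrix.cons_val', Matrix.cons_val_zero, Matrix.cons_val_one,
      Matrix.cons_val_fin_one]
    exact hm
  · show (M 1 0 : ℤ) * B' + (M 1 1 : ℤ) * D' = (q : ℤ) ^ e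
    simp only [M, Matrix.of_apply, Matrix.cons_val', Matrix.cons_val_zero, Matrix.cons_val_one,
      Matrix.cons_val_fin_one]
    exact he

end Summit.BirchSwinnertonDyer.BirchSwinnertonDyer.Theorems.ManinLocalTwoThree
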